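import Summits.ResolutionOfSingularities.ResolutionOfSingularities.Theorems.FrobeniusClosingSteerRadicandChainNonIsolated
import Summits.ResolutionOfSingularities.ResolutionOfSingularities.Theorems.FrobeniusClosingSteerNoEternalChainOne
import Literature.AlgebraicGeometry.Resolution.AdicCompletionRegular
import HarnessLib

/-!
# Crux `Steer` (stmt-ResolutionOfSingularities-16345), chain W4.1, p = 2 T-line, K-input K(3):
# ring-side structure lemmas for isolated radicand chains, II — (B2) NO EXCEPTIONAL FACTOR: the cleaned order is
# exactly `p` at every stage

OURS (campaign `res-hironaka`, rung L ★L-G4, slot W4.1; seat res-type-096 g8, FREE named-reserve hand under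
res-D-plan-1 ROUTING #14 (d), OFFER 2026-08-27T07:13:37Z; replaces the role of no printed item; NOT a statement of the
manuscript under review; AI-produced, weaker than expert review). Object: the K-input of record
`NoEternalIsolatedRadicandChainFinrank p c e` (idea-1 §σ2.13b; CHAIN v5.8/5.9, K(3) = `∀ p prime, … p 3 1`). Along the chain
the strict transform is `f (m+1) · (x m)^p = f m − (g m)^p` with `𝔪_m S(m+1) = (x m)`; this file proves that the cleaned
radicand NEVER has order more than `p`, i.e. `f (m+1)` is never divisible by the exceptional parameter — otherwise
`f (m+1) = x·y` with `y ∈ 𝔪` (multiplicity `p` plus `x ∉ 𝔪²`), a minimal prime `𝔮 ⊇ (x, y)` has height `≤ 2 < c` (Krull)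
and `f (m+1) ∈ 𝔮²` contradicts the non-isolatedness criterion (B1) of
`FrobeniusClosingSteerRadicandChainNonIsolated.lean`.

* `RadicandChain.mem_pow_of_eq_mul_of_isolated` — single member, hypothesis-free: `f₁ = x y`, `x ∈ 𝔪`, multiplicity `p`,
  isolated ⇒ `x ∈ 𝔪^p`;
* `RadicandChain.false_of_eq_mul_of_not_mem_sq_of_isolated` — the same with `x ∉ 𝔪²` ⇒ `False`;
* `RadicandChain.exc_mem_maximalIdeal`, `RadicandChain.exists_eq_exc_mul_of_mem_pow_succ` — chain bookkeeping
  (`x m ∈ 𝔪_{m+1}`; order `> p` at stage `m` ⇒ exceptional factor at stage `m+1`);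
* `RadicandChain.strictTransform_ne_exc_mul`, `RadicandChain.cleaned_not_mem_pow_succ` — **(B2)/(B2′) over the VERBATIM
  binders** of `NoEternalIsolatedRadicandChainFinrank` (`c ≥ 3`), with the exceptional parameters assumed regular
  parameters of the next member (`x m ∉ 𝔪_{m+1}²`; true for every quadratic transform of a regular local ring — kept as
  an explicit hypothesis, to be discharged by the chart structure `R[𝔪/x]/(x) ≅ κ[T]` of
  `Literature/AlgebraicGeometry/Resolution/BlowupChartQuasiRegular.lean`).

[cite: Matsumura1987, Thm. 13.5 and Thm. 14.2] [cite: Cutkosky2014, §2.1] [folklore]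
-/

noncomputable section

-- `Summit.<S>.<S>.…` duplicates the summit name by design (single-problem summit).
set_option linter.dupNamespace false

open Polynomial IsLocalRing

namespace Summit.ResolutionOfSingularities.ResolutionOfSingularities.Theorems.SwitchingDichotomy

namespace RadicandChain

universe u

/-! ## (B2) No exceptional factor: the strict transform is never divisible by the exceptional parameter -/

section B2

variable (p : ℕ) [hp : Fact p.Prime] {S₁ : Type u} [CommRing S₁] [IsDomain S₁] [IsRegularLocalRing S₁] [CharP S₁ p]

/-- **(B2), single member, hypothesis-free form.** In a regular local domain `S₁` of characteristic `p` and dimension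
`c ≥ 3`, let `f₁ = x·y` with `x ∈ 𝔪`. If `f₁` has multiplicity `p` after cleaning (`f₁ − h^p ∈ 𝔪^p` for some `h`)
and the radicand ring `S₁[X]/(X^p − f₁)` satisfies the isolatedness binder of `NoEternalIsolatedRadicandChainFinrank`,
then `x ∈ 𝔪^p`. Proof: `h ∈ 𝔪`, so `x y ∈ 𝔪^p`; if `y ∈ 𝔪` then a minimal prime `𝔮` of `(x, y)` has height `≤ 2 < c`
(Krull), is not maximal, and `f₁ ∈ 𝔮²` contradicts (B1); so `y` is a unit and `x ∈ 𝔪^p`.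
[cite: Matsumura1987, Thm. 13.5 and Thm. 14.2] [folklore] -/
theorem mem_pow_of_eq_mul_of_isolated (c : ℕ) (hc : 3 ≤ c) (hdim : ringKrullDim S₁ = c) (x y : S₁)
    (hx : x ∈ maximalIdeal S₁) (hmult : ∃ h : S₁, x * y - h ^ p ∈ maximalIdeal S₁ ^ p)
    (hisol : ∀ (Q : Ideal (AdjoinRoot ((X : S₁[X]) ^ p - C (x * y)))) [Q.IsPrime],
      (∃ Q' : Ideal (AdjoinRoot ((X : S₁[X]) ^ p - C (x * y))), Q'.IsPrime ∧ Q < Q') →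
      IsRegularLocalRing (Localization.AtPrime Q)) :
    x ∈ maximalIdeal S₁ ^ p := by
  classical
  haveI : IsRegularRing S₁ := Literature.AlgebraicGeometry.Resolution.isRegularRing_of_isRegularLocalRing S₁
  have hp0 : p ≠ 0 := hp.out.ne_zero
  obtain ⟨h, hh⟩ := hmult
  -- `h ∈ 𝔪`, hence `x y ∈ 𝔪^p`
  have hxym : x * y ∈ maximalIdeal S₁ := Ideal.mul_mem_right _ _ hx
  have hhm : h ∈ maximalIdeal S₁ := by
    have hhp : h ^ p ∈ maximalIdeal S₁ := by
      have e : h ^ p = x * y - (x * y - h ^ p) := by ring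
      rw [e]
      exact Ideal.sub_mem _ hxym (Ideal.pow_le_self hp0 hh)
    exact Ideal.IsPrime.mem_of_pow_mem inferInstance p hhp
  have hxy : x * y ∈ maximalIdeal S₁ ^ p := by
    have e : x * y = (x * y - h ^ p) + h ^ p := by ring
    rw [e]
    exact Ideal.add_mem _ hh (Ideal.pow_mem_pow hhm p)
  -- if `y` is a unit we are done
  by_cases hy : y ∈ maximalIdeal S₁
  swap
  · obtain ⟨u, rfl⟩ := (IsLocalRing.notMem_maximalIdeal.mp hy)
    have e : x = x * ↑u * ↑u⁻¹ := by rw [Units.mul_inv_cancel_right]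
    rw [e]
    exact Ideal.mul_mem_right _ _ hxy
  -- otherwise a minimal prime `𝔮` of `(x, y)` is non-maximal and contains `f₁` in its square: contradiction with (B1)
  exfalso
  set I : Ideal S₁ := Ideal.span {x, y} with hI
  have hIm : I ≤ maximalIdeal S₁ := by
    rw [hI, Ideal.span_le]
    rintro z (rfl | rfl)
    · exact hx
    · exact hy
  obtain ⟨𝔮, h𝔮min, -⟩ := Ideal.exists_minimalPrimes_le hIm
  haveI h𝔮p : 𝔮.IsPrime := h𝔮min.1.1
  have hI𝔮 : I ≤ 𝔮 := h𝔮min.1.2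
  have hht : 𝔮.height ≤ 2 := by
    have h1 : 𝔮 ∈ (Ideal.span (({x, y} : Finset S₁) : Set S₁)).minimalPrimes := by
      rw [Finset.coe_insert, Finset.coe_singleton]; exact h𝔮min
    exact (Ideal.height_le_card_of_mem_minimalPrimes_span_finset h1).trans (by exact_mod_cast Finset.card_le_two)
  have hne : 𝔮 ≠ maximalIdeal S₁ := by
    intro e
    have hm : ((maximalIdeal S₁).height : WithBot ℕ∞) = (c : WithBot ℕ∞) := by
      rw [IsLocalRing.maximalIdeal_height_eq_ringKrullDim, hdim]
    have hm' : (maximalIdeal S₁).height = c := by exact_mod_cast hm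
    rw [e, hm'] at hht
    have : c ≤ 2 := by exact_mod_cast hht
    omega
  have hnotmax : ¬ 𝔮.IsMaximal := fun hM => hne (IsLocalRing.eq_maximalIdeal hM)
  have hf𝔮 : x * y - 0 ^ p ∈ 𝔮 ^ 2 := by
    rw [zero_pow hp0, sub_zero, pow_two]
    exact Ideal.mul_mem_mul (hI𝔮 (Ideal.subset_span (by simp))) (hI𝔮 (Ideal.subset_span (by simp)))
  exact sub_pow_not_mem_sq_of_isolated p (x * y) hisol 𝔮 hnotmax 0 hf𝔮

/-- **(B2), single member.** In a regular local domain `S₁` of characteristic `p` and dimension `c ≥ 3`, a radicand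
of the form `f₁ = x·y` with `x` a REGULAR PARAMETER (`x ∈ 𝔪 ∖ 𝔪²`) cannot have multiplicity `p` after cleaning and an
isolated radicand singularity at the same time. In the chain: the strict transform `f (m+1)` is never divisible by
the exceptional parameter `x m`, i.e. the cleaned order of `f m − (g m)^p` is exactly `p`.
[cite: Matsumura1987, Thm. 13.5 and Thm. 14.2] [folklore] -/
theorem false_of_eq_mul_of_not_mem_sq_of_isolated (c : ℕ) (hc : 3 ≤ c) (hdim : ringKrullDim S₁ = c) (x y : S₁)
    (hx : x ∈ maximalIdeal S₁) (hx2 : x ∉ maximalIdeal S₁ ^ 2)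
    (hmult : ∃ h : S₁, x * y - h ^ p ∈ maximalIdeal S₁ ^ p)
    (hisol : ∀ (Q : Ideal (AdjoinRoot ((X : S₁[X]) ^ p - C (x * y)))) [Q.IsPrime],
      (∃ Q' : Ideal (AdjoinRoot ((X : S₁[X]) ^ p - C (x * y))), Q'.IsPrime ∧ Q < Q') →
      IsRegularLocalRing (Localization.AtPrime Q)) : False :=
  hx2 (Ideal.pow_le_pow_right hp.out.two_le (mem_pow_of_eq_mul_of_isolated p c hc hdim x y hx hmult hisol))

end B2

/-! ## (B2) for the chain: the binders of `NoEternalIsolatedRadicandChainFinrank` -/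

section Chain

open Literature.AlgebraicGeometry.Resolution

variable (p : ℕ) [hp : Fact p.Prime] {L : Type} [Field L] [CharP L p]

/-- In the chain, the exceptional parameter `x m` lies in the maximal ideal of `S (m+1)` (from the binder
`𝔪_m · S(m+1) = (x m)` and domination along the quadratic transform). [cite: Cutkosky2014, §2.1] [folklore] -/
theorem exc_mem_maximalIdeal (S : ℕ → Subring L) [∀ m, IsLocalRing (S m)] (hle : ∀ m, S m ≤ S (m + 1))
    (x : ∀ m, S (m + 1)) (hQT : ∀ m, IsQuadraticTransform (S m) (S (m + 1)))
    (hspan : ∀ m, Ideal.span ((fun y : S m => (⟨(y : L), hle m y.2⟩ : S (m + 1))) ''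
        (maximalIdeal (S m) : Set (S m))) = Ideal.span {x m}) (m : ℕ) :
    x m ∈ maximalIdeal (S (m + 1)) := by
  have hxs : x m ∈ Ideal.span {x m} := Ideal.mem_span_singleton_self _
  rw [← hspan m] at hxs
  refine (Ideal.span_le.mpr ?_) hxs
  rintro _ ⟨y, hy, rfl⟩
  exact NoEternalChainOne.inclusion_mem_maximalIdeal_of_subringDominates (hQT m).dominates hy

omit hp [CharP L p] in
/-- **Order bookkeeping along one step of the chain.** From `f (m+1) · (x m)^p = f m − (g m)^p` and
`𝔪_m · S(m+1) = (x m)`: if the cleaned radicand has order MORE than `p` at stage `m` (`f m − (g m)^p ∈ 𝔪_m^(p+1)`), then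
the strict transform acquires an exceptional factor, `f (m+1) = x m · z`. [cite: Cutkosky2014, §2.1] [folklore] -/
theorem exists_eq_exc_mul_of_mem_pow_succ (S : ℕ → Subring L) [∀ m, IsLocalRing (S m)] (hle : ∀ m, S m ≤ S (m + 1))
    (f g : ∀ m, S m) (x : ∀ m, S (m + 1))
    (hspan : ∀ m, Ideal.span ((fun y : S m => (⟨(y : L), hle m y.2⟩ : S (m + 1))) ''
        (maximalIdeal (S m) : Set (S m))) = Ideal.span {x m})
    (hrel : ∀ m, ((f (m + 1) : S (m + 1)) : L) * ((x m : S (m + 1)) : L) ^ p =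
        ((f m : S m) : L) - ((g m : S m) : L) ^ p)
    (m : ℕ) (hx0 : x m ≠ 0) (hord : f m - g m ^ p ∈ maximalIdeal (S m) ^ (p + 1)) :
    ∃ z : S (m + 1), f (m + 1) = x m * z := by
  let ι : S m →+* S (m + 1) := Subring.inclusion (hle m)
  have hι : ∀ y : S m, ι y = ⟨(y : L), hle m y.2⟩ := fun y => rfl
  have hmap : (maximalIdeal (S m)).map ι = Ideal.span {x m} := by
    rw [Ideal.map, ← hspan m]
    congr 1
  have hmem : ι (f m - g m ^ p) ∈ Ideal.span {x m ^ (p + 1)} := by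
    have := Ideal.mem_map_of_mem ι hord
    rwa [Ideal.map_pow, hmap, Ideal.span_singleton_pow] at this
  obtain ⟨z, hz⟩ := Ideal.mem_span_singleton'.mp hmem
  refine ⟨z, ?_⟩
  have hxL : ((x m : S (m + 1)) : L) ≠ 0 := fun e => hx0 (Subtype.ext e)
  have hzL : (z : L) * ((x m : S (m + 1)) : L) ^ (p + 1) = ((f m : S m) : L) - ((g m : S m) : L) ^ p := by
    have := congrArg (fun w : S (m + 1) => (w : L)) hz
    simpa [map_sub, map_pow, hι] using this
  apply Subtype.ext
  show ((f (m + 1) : S (m + 1)) : L) = ((x m : S (m + 1)) : L) * (z : L)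
  have h1 := hrel m
  rw [← hzL, pow_succ', ← mul_assoc] at h1
  have h2 := mul_right_cancel₀ (pow_ne_zero p hxL) h1
  rw [h2, mul_comm]

/-- **(B2) for the chain — NO EXCEPTIONAL FACTOR.** Under the binders of `NoEternalIsolatedRadicandChainFinrank p c e`
with `c ≥ 3` (members regular local of dimension `c` inside a field of characteristic `p`, exceptional parameters
`x m` with `𝔪_m S(m+1) = (x m)`, multiplicity `p` after cleaning and isolated radicand singularity at every stage), and
assuming the exceptional parameters are regular parameters (`x m ∉ 𝔪_{m+1}²` — automatic for a quadratic transform of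
a regular local ring; kept as an explicit hypothesis here), the strict transform `f (m+1)` is never a multiple of
`x m`. The quadratic-transform, excellence, p-rank and Frobenius-relation binders are not used.
[cite: Matsumura1987, Thm. 13.5 and Thm. 14.2] [folklore] -/
theorem strictTransform_ne_exc_mul (S : ℕ → Subring L) [∀ m, IsLocalRing (S m)] (c : ℕ) (hc : 3 ≤ c)
    (f : ∀ m, S m) (x : ∀ m, S (m + 1))
    (hreg : ∀ m, IsRegularLocalRing (S m)) (hdim : ∀ m, ringKrullDim (S m) = c)
    (hxm : ∀ m, x m ∈ maximalIdeal (S (m + 1))) (hx2 : ∀ m, x m ∉ maximalIdeal (S (m + 1)) ^ 2)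
    (hmult : ∀ m, ∃ h : S m, f m - h ^ p ∈ maximalIdeal (S m) ^ p)
    (hisol : ∀ m, ∀ (Q : Ideal (AdjoinRoot ((X : (S m)[X]) ^ p - C (f m)))) [Q.IsPrime],
      (∃ Q' : Ideal (AdjoinRoot ((X : (S m)[X]) ^ p - C (f m))), Q'.IsPrime ∧ Q < Q') →
      IsRegularLocalRing (Localization.AtPrime Q))
    (m : ℕ) (z : S (m + 1)) : f (m + 1) ≠ x m * z := by
  intro e
  haveI := hreg (m + 1)
  have hmult' : ∃ h : S (m + 1), x m * z - h ^ p ∈ maximalIdeal (S (m + 1)) ^ p := by rw [← e]; exact hmult (m + 1)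
  refine false_of_eq_mul_of_not_mem_sq_of_isolated p c hc (hdim (m + 1)) (x m) z (hxm m) (hx2 m) hmult' ?_
  intro Q hQ hQ'
  have h := hisol (m + 1)
  rw [e] at h
  exact h Q hQ'

/-- **(B2′) for the chain — CLEANED ORDER EXACTLY `p`.** Same hypotheses plus the transform law
`f (m+1) · (x m)^p = f m − (g m)^p`: the cleaned radicand `f m − (g m)^p` never lies in `𝔪_m^(p+1)` (its order is
exactly `p`, the transform law and the multiplicity binder giving `≥ p`). [cite: Cutkosky2014, §2.1] [folklore] -/
theorem cleaned_not_mem_pow_succ (S : ℕ → Subring L) [∀ m, IsLocalRing (S m)] (c : ℕ) (hc : 3 ≤ c)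
    (hle : ∀ m, S m ≤ S (m + 1)) (f g : ∀ m, S m) (x : ∀ m, S (m + 1))
    (hreg : ∀ m, IsRegularLocalRing (S m)) (hdim : ∀ m, ringKrullDim (S m) = c)
    (hspan : ∀ m, Ideal.span ((fun y : S m => (⟨(y : L), hle m y.2⟩ : S (m + 1))) ''
        (maximalIdeal (S m) : Set (S m))) = Ideal.span {x m})
    (hrel : ∀ m, ((f (m + 1) : S (m + 1)) : L) * ((x m : S (m + 1)) : L) ^ p =
        ((f m : S m) : L) - ((g m : S m) : L) ^ p)
    (hxm : ∀ m, x m ∈ maximalIdeal (S (m + 1))) (hx2 : ∀ m, x m ∉ maximalIdeal (S (m + 1)) ^ 2)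
    (hmult : ∀ m, ∃ h : S m, f m - h ^ p ∈ maximalIdeal (S m) ^ p)
    (hisol : ∀ m, ∀ (Q : Ideal (AdjoinRoot ((X : (S m)[X]) ^ p - C (f m)))) [Q.IsPrime],
      (∃ Q' : Ideal (AdjoinRoot ((X : (S m)[X]) ^ p - C (f m))), Q'.IsPrime ∧ Q < Q') →
      IsRegularLocalRing (Localization.AtPrime Q))
    (m : ℕ) : f m - g m ^ p ∉ maximalIdeal (S m) ^ (p + 1) := by
  intro hord
  have hx0 : x m ≠ 0 := fun e => hx2 m (by rw [e]; exact Ideal.zero_mem _)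
  obtain ⟨z, hz⟩ := exists_eq_exc_mul_of_mem_pow_succ p S hle f g x hspan hrel m hx0 hord
  exact strictTransform_ne_exc_mul p S c hc f x hreg hdim hxm hx2 hmult hisol m z hz

end Chain

end RadicandChain

end Summit.ResolutionOfSingularities.ResolutionOfSingularities.Theorems.SwitchingDichotomy

end
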